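import Summits.Ventures.CertifiedManyBodySolver.Observables.StiffnessApexTransportCurtainDoped
import Summits.Ventures.CertifiedManyBodySolver.Observables.StiffnessApexTransportCurtainLadder
import HarnessLib

/-!
# Ventures/CertifiedManyBodySolver — Observables/StiffnessApexTransportTargetSlot.lean

HONEST FRAMING: one-sided certified CEILINGS on the uniform flux stiffness (`t–t′` f-sum class) at ANY density, transported into a `(t′, U)`
box from ONE station WITHOUT ANY `K₂` INPUT; a ceiling never speaks to the presence of order; not a `T_c` estimate, not a superconductivity
verdict; every leaf is CONDITIONAL on the (two-parameter) row family it names. Zero compute, no definition, no claim node, no `sorry`.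

Cell `pub/hubbard-downfold` (D-0150 L-DF2 «box ↦ one word»; D-0154 coverage boxes are DOPED), seat `hubbard-downfold-unc-2`
(`prover-hubbard-downfold-unc-2-g15-0`); sequel of `Observables/StiffnessApexTransportCurtainDoped.lean`. THE POINT. Away from `n = 1` every one-station
edition so far (companion `…Doped` §2: own slots, lever `(−p)(1 − U_A/U_max)`; `…CurtainDoped`: corner slot on the overhang, lever `min(q − p, ·)`) pays a
`K₂` price `(t′_P − σ)(−B)/2` because the source row's hopping slot `σ` differs from the target's `t′_P`, and so needs a certified `K₂` FLOOR `B` at the doped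
station (a «min K₂diag» solve or a particle–hole window) — the load-bearing input of M2(c) as planned. But the apex row transports the TARGET's objective
EXACTLY at every density: if the station family certifies, at each source `s`, the f-sum objective at EVERY slot `σ` it serves — the two-parameter family
`(σ, s)`, `σ ∈ [p, q]`, `s ∈ [σ(2 − U_A/U_max), σ]` — then the slot equals the target's and the lever is ZERO: NO `K₂` word, no particle–hole window, at any
density. Producer-side this is the boxdual technology already in use with ONE more affine direction, and that direction is COVARIANCE-FREE: `σ` enters only the
objective row (`X₀(σ)` is affine in `σ`, `oddMomentObsTT_lamZero_affine`), never the feasibility rows, so interpolating vertex certificates in `σ` adds no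
`L`-term — per station sub-segment: the two vertex solves of record, each read with TWO objectives (`σ` = the sub-segment's extreme target slots).

* §1 `ObsStiffnessSeqCeilingAt_on_box_of_apexStation_targetSlot` — THE TARGET-SLOT STATION THEOREM (any `0 ≤ n < 2`): the family `val σ s` on
  `{(σ, s) : p ≤ σ ≤ q, σ(2 − U_A/U_max) ≤ s ≤ σ} × {U_A}` for the objective `−X₀(σ)`, with `−val σ s ≤ c`, words the box `[p, q] × [U_A, U_max]` at density `n`;
* §2 `…_on_box3_of_apexStation_targetSlot` — the filling interval rides along (families indexed by the density);
* §3 the point form `ObsStiffnessSeqCeilingAt_of_apexSource_targetSlot_orbitLower` (one source, the target's own slot, `U_A ≤ U_P`; the companion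
  `StiffnessApexTransport` §2 `…_of_apexSource_orbitLowerRow` is its certified-row, `U_A < U_P` form).

NOT said: nothing flows toward smaller `U`; `λ ≠ 0` words are not of this form; no `T > 0`; no number of record. At `n = 1` the target-slot family is
unnecessary (the corner slot is free, `…Curtain`).

References: T. Koma, H. Tasaki, J. Stat. Phys. 76 (1994) 745, §1 [KomaTasaki1994]; D. J. Scalapino, S. R. White, S.-C. Zhang, PRB 47 (1993)
7995, §II [ScalapinoWhiteZhang1993]; E. H. Lieb, M. Loss, Duke Math. J. 71 (1993) 337, §8 Thm. 8.2 [LiebLoss1993].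
-/

noncomputable section

namespace Summit.Ventures.CertifiedManyBodySolver.Observables

open Literature.MathematicalPhysics.QuantumLattice
open Literature.MathematicalPhysics.QuantumLattice.ThermodynamicLimit
open Literature.MathematicalPhysics.QuantumFieldTheory
open Literature.Probability.LatticeModels
open Matrix Finset Filter Topology HubbardWave0
open scoped Matrix BigOperators ComplexOrder

/-! ## §3 (stated first, used below) The point form: one source read at the TARGET's own slot, any density, no `K₂` input -/

section Point

variable {t'A UA t'P UP n : ℝ}

/-- **Apex leaf at the target's own slot (any density, `U_A ≤ U_P`, no `K₂` input).** Source `A = (t′_A, U_A)` on the apex segment of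
`P = (t′_P, U_P)` (`U_P·t′_A = (2U_P − U_A)·t′_P`, `0 ≤ U_A ≤ U_P`, `0 < U_P`), density `0 ≤ n < 2`; an unconditional orbit-lower statement
`v ≤ |D₄|⁻¹ Σ_γ Re ω_γ(−X₀(t′_P, Uo))` for the TARGET's f-sum objective on the source class ⇒ `ObsStiffnessSeqCeilingAt t′_P U_P n c` for every `c ≥ −v`
(the priced slot engine at `σ = t′_P`: lever zero; its `K₂` slot is fed the kinematic floor `−1.6211390 ≤ K₂`, which every class carries).
[cite: KomaTasaki1994, §1] [cite: ScalapinoWhiteZhang1993, §II] -/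
theorem ObsStiffnessSeqCeilingAt_of_apexSource_targetSlot_orbitLower (Uo v : ℝ) (hUA : 0 ≤ UA) (hU : UA ≤ UP) (hUP : 0 < UP)
    (hapex : UP * t'A = (2 * UP - UA) * t'P) (hn0 : 0 ≤ n) (hn2 : n < 2)
    (h : ∀ (ω : InfVolFermionState 2) (Ls : ℕ → ℕ) (ψ : ∀ L, Fock (Orb (FermionTorus 2 L))),
      Tendsto Ls atTop atTop →
      (∀ j, IsGroundStateInSector (hubbardTorusTT' (Ls j) 1 t'A UA) (rectN n (Ls j)) 0 (ψ (Ls j))) →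
      (∀ j, star (ψ (Ls j)) ⬝ᵥ ψ (Ls j) = 1) → ω.IsTorusLimitOf ψ Ls →
      v ≤ ((Finset.univ : Finset (DihedralGroup 4)).card : ℝ)⁻¹ * ∑ g ∈ (Finset.univ : Finset (DihedralGroup 4)),
        (ω.expect (d4ShiftSet g 0 (box 2 7)) (fermionEmbed (PolySite.d4Emb g 0 (box 2 7)) (-oddMomentObsTT t'P Uo 0))).re)
    (c : ℚ) (hc : -v ≤ ((c : ℚ) : ℝ)) :
    ObsStiffnessSeqCeilingAt t'P UP n c := by
  refine ObsStiffnessSeqCeilingAt_of_apexSource_orbitLower_slot_of_le_diagHop t'P Uo v hUA hU hUP hapex le_rfl hn0 hn2 h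
    (B := -(1.6211390 : ℝ)) (fun ω Ls ψ hLs hψ h1 hω => ?_) c (by
      have e : (t'P - t'P) * (-(1.6211390 : ℝ)) / 2 = 0 := by ring
      linarith)
  have hN : ∀ j, IsNParticle (rectN n (Ls j)) (ψ (Ls j)) := fun j => ((mem_szSector_iff _ _ _).1 (hψ j).1).1
  exact (abs_le.1 (hω.abs_meanEnergy_diagHop_le_decimal hn0 hn2 hLs hN h1)).1

end Point

/-! ## §1 THE TARGET-SLOT STATION THEOREM (any density, no `K₂` input) -/

section Station

variable {UA Umax p q n : ℝ}

/-- **THE TARGET-SLOT STATION THEOREM.** Station `0 < U_A`, box `[p, q] × [U_A, U_max]` with `q ≤ 0`, density `0 ≤ n < 2`. A TWO-PARAMETER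
unconditional orbit-lower family on the station: for every target slot `σ ∈ [p, q]` and every source `s ∈ [σ(2 − U_A/U_max), σ]`, on the torus-limit
ground-state class at `(s, U_A, n)`, `val σ s ≤ |D₄|⁻¹ Σ_γ Re ω_γ(−X₀(σ, U_A))` (the f-sum objective AT THE SLOT `σ`, not at `s`), with `−val σ s ≤ c`.
Then `ObsStiffnessSeqCeilingAt t′ U n c` at EVERY point of the box — with NO `K₂` floor, NO particle–hole window, NO lever: the target `(t′, U)` is served
by the source `s = t′(2U − U_A)/U ∈ [t′(2 − U_A/U_max), t′]` read at the slot `σ = t′`. Producer object: the station bundles of record with the objective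
interpolated in `σ` as well (covariance-free direction: `σ` enters the objective row only). [cite: KomaTasaki1994, §1] [cite: ScalapinoWhiteZhang1993, §II] -/
theorem ObsStiffnessSeqCeilingAt_on_box_of_apexStation_targetSlot (hUA : 0 < UA) (hq : q ≤ 0) (hn0 : 0 ≤ n) (hn2 : n < 2)
    (val : ℝ → ℝ → ℝ) (c : ℚ)
    (h : ∀ σ ∈ Set.Icc p q, ∀ s ∈ Set.Icc (σ * (2 - UA / Umax)) σ,
      ∀ (ω : InfVolFermionState 2) (Ls : ℕ → ℕ) (ψ : ∀ L, Fock (Orb (FermionTorus 2 L))),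
      Tendsto Ls atTop atTop →
      (∀ j, IsGroundStateInSector (hubbardTorusTT' (Ls j) 1 s UA) (rectN n (Ls j)) 0 (ψ (Ls j))) →
      (∀ j, star (ψ (Ls j)) ⬝ᵥ ψ (Ls j) = 1) → ω.IsTorusLimitOf ψ Ls →
      val σ s ≤ ((Finset.univ : Finset (DihedralGroup 4)).card : ℝ)⁻¹ * ∑ g ∈ (Finset.univ : Finset (DihedralGroup 4)),
        (ω.expect (d4ShiftSet g 0 (box 2 7)) (fermionEmbed (PolySite.d4Emb g 0 (box 2 7)) (-oddMomentObsTT σ UA 0))).re)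
    (hc : ∀ σ ∈ Set.Icc p q, ∀ s ∈ Set.Icc (σ * (2 - UA / Umax)) σ, -val σ s ≤ ((c : ℚ) : ℝ)) :
    ∀ tp ∈ Set.Icc p q, ∀ U ∈ Set.Icc UA Umax, ObsStiffnessSeqCeilingAt tp U n c := by
  intro tp htp U hU
  have hUP : 0 < U := hUA.trans_le hU.1
  have htp0 : tp ≤ 0 := htp.2.trans hq
  -- the source parameter lies in `[t′(2 − U_A/U_max), t′]` (the slab lemma on the degenerate box `[t′, t′]`)
  have hs : tp * (2 * U - UA) / U ∈ Set.Icc (tp * (2 - UA / Umax)) tp :=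
    apexSource_mem_Icc_of_slab (p := tp) (q := tp) hUA hU.1 hU.2 htp0 ⟨le_rfl, le_rfl⟩
  have hapex : U * (tp * (2 * U - UA) / U) = (2 * U - UA) * tp := by
    rw [mul_div_assoc', mul_div_cancel_left₀ _ hUP.ne']; ring
  exact ObsStiffnessSeqCeilingAt_of_apexSource_targetSlot_orbitLower UA (val tp (tp * (2 * U - UA) / U)) hUA.le hU.1 hUP hapex hn0 hn2
    (h tp htp _ hs) c (hc tp htp _ hs)

/-- **Two-slot (σ-chord) form at one station.** If, for every target slot `σ ∈ [p, q]` (`p < q`), the family is the CHORD IN `σ` of two families certified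
for the END objectives `−X₀(p)` and `−X₀(q)` — `val σ s = ((q − σ)·vP s + (σ − p)·vQ s)/(q − p)` (what reading each station certificate with the two end
objectives and interpolating gives; `σ` is covariance-free) — and `−vP s ≤ c`, `−vQ s ≤ c` wherever used, then the box is worded with `c`.
[cite: KomaTasaki1994, §1] [cite: ScalapinoWhiteZhang1993, §II] -/
theorem ObsStiffnessSeqCeilingAt_on_box_of_apexStation_targetSlot_chord (hUA : 0 < UA) (hq : q ≤ 0) (hpq : p < q) (hn0 : 0 ≤ n)
    (hn2 : n < 2) (vP vQ : ℝ → ℝ) (c : ℚ)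
    (h : ∀ σ ∈ Set.Icc p q, ∀ s ∈ Set.Icc (σ * (2 - UA / Umax)) σ,
      ∀ (ω : InfVolFermionState 2) (Ls : ℕ → ℕ) (ψ : ∀ L, Fock (Orb (FermionTorus 2 L))),
      Tendsto Ls atTop atTop →
      (∀ j, IsGroundStateInSector (hubbardTorusTT' (Ls j) 1 s UA) (rectN n (Ls j)) 0 (ψ (Ls j))) →
      (∀ j, star (ψ (Ls j)) ⬝ᵥ ψ (Ls j) = 1) → ω.IsTorusLimitOf ψ Ls →
      (q - σ) / (q - p) * vP s + (σ - p) / (q - p) * vQ s ≤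
        ((Finset.univ : Finset (DihedralGroup 4)).card : ℝ)⁻¹ * ∑ g ∈ (Finset.univ : Finset (DihedralGroup 4)),
          (ω.expect (d4ShiftSet g 0 (box 2 7)) (fermionEmbed (PolySite.d4Emb g 0 (box 2 7)) (-oddMomentObsTT σ UA 0))).re)
    (hcP : ∀ σ ∈ Set.Icc p q, ∀ s ∈ Set.Icc (σ * (2 - UA / Umax)) σ, -vP s ≤ ((c : ℚ) : ℝ))
    (hcQ : ∀ σ ∈ Set.Icc p q, ∀ s ∈ Set.Icc (σ * (2 - UA / Umax)) σ, -vQ s ≤ ((c : ℚ) : ℝ)) :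
    ∀ tp ∈ Set.Icc p q, ∀ U ∈ Set.Icc UA Umax, ObsStiffnessSeqCeilingAt tp U n c := by
  refine ObsStiffnessSeqCeilingAt_on_box_of_apexStation_targetSlot hUA hq hn0 hn2
    (fun σ s => (q - σ) / (q - p) * vP s + (σ - p) / (q - p) * vQ s) c h fun σ hσ s hs => ?_
  obtain ⟨hl₁, hl₂, hsum, -, -⟩ := tPrimeSegment_weights hpq hσ.1 hσ.2
  have hmin := min_le_chord_of_weights (c₁ := vP s) (c₂ := vQ s) hl₁ hl₂ hsum
  have hneg : -min (vP s) (vQ s) ≤ ((c : ℚ) : ℝ) := by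
    rcases le_total (vP s) (vQ s) with hv | hv
    · rw [min_eq_left hv]; exact hcP σ hσ s hs
    · rw [min_eq_right hv]; exact hcQ σ hσ s hs
  linarith

end Station

/-! ## §2 The 3-D box: the filling interval rides along -/

section Box3

variable {UA Umax p q n₁ n₂ : ℝ}

/-- **TARGET-SLOT STATION on the 3-D box `[p,q] × [U_A,U_max] × [n₁,n₂]`** (`[n₁, n₂] ⊆ [0, 2)`): a density-indexed two-parameter family `val x σ s`
for the objective `−X₀(σ)` on the classes at `(s, U_A, x)`, `σ ∈ [p, q]`, `s ∈ [σ(2 − U_A/U_max), σ]`, with `−val x σ s ≤ c` ⇒ `ObsStiffnessSeqCeilingAt t′ U x c`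
on the whole 3-D box — the hypothesis shape `Downfold/StiffnessSeam.holdsOn_stiffnessSeqCeilingAt_of_cell` consumes; no `K₂` input at any density.
[cite: KomaTasaki1994, §1] [cite: ScalapinoWhiteZhang1993, §II] -/
theorem ObsStiffnessSeqCeilingAt_on_box3_of_apexStation_targetSlot (hUA : 0 < UA) (hq : q ≤ 0) (hn₁ : 0 ≤ n₁) (hn₂ : n₂ < 2)
    (val : ℝ → ℝ → ℝ → ℝ) (c : ℚ)
    (h : ∀ x ∈ Set.Icc n₁ n₂, ∀ σ ∈ Set.Icc p q, ∀ s ∈ Set.Icc (σ * (2 - UA / Umax)) σ,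
      ∀ (ω : InfVolFermionState 2) (Ls : ℕ → ℕ) (ψ : ∀ L, Fock (Orb (FermionTorus 2 L))),
      Tendsto Ls atTop atTop →
      (∀ j, IsGroundStateInSector (hubbardTorusTT' (Ls j) 1 s UA) (rectN x (Ls j)) 0 (ψ (Ls j))) →
      (∀ j, star (ψ (Ls j)) ⬝ᵥ ψ (Ls j) = 1) → ω.IsTorusLimitOf ψ Ls →
      val x σ s ≤ ((Finset.univ : Finset (DihedralGroup 4)).card : ℝ)⁻¹ * ∑ g ∈ (Finset.univ : Finset (DihedralGroup 4)),
        (ω.expect (d4ShiftSet g 0 (box 2 7)) (fermionEmbed (PolySite.d4Emb g 0 (box 2 7)) (-oddMomentObsTT σ UA 0))).re)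
    (hc : ∀ x ∈ Set.Icc n₁ n₂, ∀ σ ∈ Set.Icc p q, ∀ s ∈ Set.Icc (σ * (2 - UA / Umax)) σ, -val x σ s ≤ ((c : ℚ) : ℝ)) :
    ∀ tp ∈ Set.Icc p q, ∀ U ∈ Set.Icc UA Umax, ∀ x ∈ Set.Icc n₁ n₂, ObsStiffnessSeqCeilingAt tp U x c := by
  intro tp htp U hU x hx
  exact ObsStiffnessSeqCeilingAt_on_box_of_apexStation_targetSlot hUA hq (hn₁.trans hx.1) (hx.2.trans_lt hn₂) (val x) c (h x hx)
    (hc x hx) tp htp U hU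

end Box3

/-! ## §4 (append, same seat) The LADDER of target-slot stations (any density, no `K₂` input): short station segments, every target read at its own slot -/

section Ladder

variable {p q n : ℝ}

/-- **THE TARGET-SLOT LADDER (any density).** Stations `U : ℕ → ℝ` with `0 < U_0`, `U_k ≤ U_{k+1}` for `k < m` (`0 < m`); targets `t′ ∈ [p, q]`, `q ≤ 0`;
density `0 ≤ n < 2`. For every station `k < m` a two-parameter family `val k σ s` for the objective `−X₀(σ, U_k)` on the classes at `(s, U_k, n)`, target slots
`σ ∈ [p, q]`, sources `s ∈ [σ(2 − U_k/U_{k+1}), σ]` (the station segment only reaches `p(2 − U_k/U_{k+1})`, short when the ladder is dense), with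
`−val k σ s ≤ c`. Then `ObsStiffnessSeqCeilingAt t′ u n c` at every `(t′, u) ∈ [p, q] × [U_0, U_m]` — §1 on each slab; NO `K₂` word, NO lever anywhere.
[cite: KomaTasaki1994, §1] [cite: ScalapinoWhiteZhang1993, §II] -/
theorem ObsStiffnessSeqCeilingAt_on_box_of_apexLadder_targetSlot (U : ℕ → ℝ) {m : ℕ} (hm : 0 < m) (hU0 : 0 < U 0)
    (hmono : ∀ k < m, U k ≤ U (k + 1)) (hq : q ≤ 0) (hn0 : 0 ≤ n) (hn2 : n < 2) (val : ℕ → ℝ → ℝ → ℝ) (c : ℚ)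
    (h : ∀ k < m, ∀ σ ∈ Set.Icc p q, ∀ s ∈ Set.Icc (σ * (2 - U k / U (k + 1))) σ,
      ∀ (ω : InfVolFermionState 2) (Ls : ℕ → ℕ) (ψ : ∀ L, Fock (Orb (FermionTorus 2 L))),
      Tendsto Ls atTop atTop →
      (∀ j, IsGroundStateInSector (hubbardTorusTT' (Ls j) 1 s (U k)) (rectN n (Ls j)) 0 (ψ (Ls j))) →
      (∀ j, star (ψ (Ls j)) ⬝ᵥ ψ (Ls j) = 1) → ω.IsTorusLimitOf ψ Ls →
      val k σ s ≤ ((Finset.univ : Finset (DihedralGroup 4)).card : ℝ)⁻¹ * ∑ g ∈ (Finset.univ : Finset (DihedralGroup 4)),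
        (ω.expect (d4ShiftSet g 0 (box 2 7)) (fermionEmbed (PolySite.d4Emb g 0 (box 2 7)) (-oddMomentObsTT σ (U k) 0))).re)
    (hc : ∀ k < m, ∀ σ ∈ Set.Icc p q, ∀ s ∈ Set.Icc (σ * (2 - U k / U (k + 1))) σ, -val k σ s ≤ ((c : ℚ) : ℝ)) :
    ∀ tp ∈ Set.Icc p q, ∀ u ∈ Set.Icc (U 0) (U m), ObsStiffnessSeqCeilingAt tp u n c := by
  have hpos : ∀ k, k ≤ m → 0 < U k := by
    intro k
    induction k with
    | zero => exact fun _ => hU0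
    | succ j ih => exact fun hj => (ih (Nat.le_of_succ_le hj)).trans_le (hmono j (Nat.lt_of_succ_le hj))
  intro tp htp u hu
  obtain ⟨k, hk, huk⟩ := exists_step_of_mem_Icc_chain hm hmono hu
  exact ObsStiffnessSeqCeilingAt_on_box_of_apexStation_targetSlot (Umax := U (k + 1)) (hpos k hk.le) hq hn0 hn2 (val k) c (h k hk)
    (hc k hk) tp htp u huk

end Ladder

/-! ## §5 (append, same seat) The target-slot family FROM TWO ORDINARY BUNDLES: the end objectives `−X₀(p)`, `−X₀(q)` on the station segment -/

section TwoEndObjectives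

variable {UA Umax p q n : ℝ}

/-- **The f-sum orbit mean is AFFINE in the slot**: for a translation-invariant `ω` and `p < q`, `σ ∈ [p, q]`, two orbit-lower values `vP ≤` orbit mean
of `−X₀(p, Uo)` and `vQ ≤` orbit mean of `−X₀(q, Uo)` give the `σ`-chord `((q − σ)vP + (σ − p)vQ)/(q − p) ≤` orbit mean of `−X₀(σ, Uo)` — the orbit mean
is `¼e_{Φ(1,2σ,0)}(ω) = ¼(K₁ + 2σK₂)`, affine in `σ`. So two single-objective families ARE a target-slot family; no joint certificate is needed.
[cite: HazraVermaRanderia2019, eq. (4)] -/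
theorem orbitLower_slot_chord_of_two_endObjectives {ω : InfVolFermionState 2} (hω : ω.IsTranslationInvariant) (Uo : ℝ) {σ vP vQ : ℝ}
    (hpq : p < q) (hσ : σ ∈ Set.Icc p q)
    (hP : vP ≤ ((Finset.univ : Finset (DihedralGroup 4)).card : ℝ)⁻¹ * ∑ g ∈ (Finset.univ : Finset (DihedralGroup 4)),
      (ω.expect (d4ShiftSet g 0 (box 2 7)) (fermionEmbed (PolySite.d4Emb g 0 (box 2 7)) (-oddMomentObsTT p Uo 0))).re)
    (hQ : vQ ≤ ((Finset.univ : Finset (DihedralGroup 4)).card : ℝ)⁻¹ * ∑ g ∈ (Finset.univ : Finset (DihedralGroup 4)),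
      (ω.expect (d4ShiftSet g 0 (box 2 7)) (fermionEmbed (PolySite.d4Emb g 0 (box 2 7)) (-oddMomentObsTT q Uo 0))).re) :
    (q - σ) / (q - p) * vP + (σ - p) / (q - p) * vQ ≤
      ((Finset.univ : Finset (DihedralGroup 4)).card : ℝ)⁻¹ * ∑ g ∈ (Finset.univ : Finset (DihedralGroup 4)),
        (ω.expect (d4ShiftSet g 0 (box 2 7)) (fermionEmbed (PolySite.d4Emb g 0 (box 2 7)) (-oddMomentObsTT σ Uo 0))).re := by
  rw [orbitMean_re_expect_neg_oddMomentTT_lam_zero hω] at hP hQ ⊢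
  obtain ⟨hw1, hw2, -, -, -⟩ := tPrimeSegment_weights hpq hσ.1 hσ.2
  have eQ := ω.meanEnergy_hubbardTTPrime_affine 1 (2 * p) 0 (2 * q) 0
  have eσ := ω.meanEnergy_hubbardTTPrime_affine 1 (2 * p) 0 (2 * σ) 0
  rw [sub_self, zero_mul, add_zero] at eQ eσ
  have hd : q - p ≠ 0 := sub_ne_zero.2 (ne_of_gt hpq)
  calc (q - σ) / (q - p) * vP + (σ - p) / (q - p) * vQ
      ≤ (q - σ) / (q - p) * ((1 / 4) * ω.meanEnergy (hubbardTTPrimeFermionInteraction 1 (2 * p) 0) 1) +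
          (σ - p) / (q - p) * ((1 / 4) * ω.meanEnergy (hubbardTTPrimeFermionInteraction 1 (2 * q) 0) 1) :=
        add_le_add (mul_le_mul_of_nonneg_left hP hw1) (mul_le_mul_of_nonneg_left hQ hw2)
    _ = (1 / 4) * ω.meanEnergy (hubbardTTPrimeFermionInteraction 1 (2 * σ) 0) 1 := by
        rw [eQ, eσ]
        field_simp
        ring

/-- **THE DOPED BOX FROM TWO ORDINARY STATION BUNDLES, NO `K₂` INPUT.** Station `0 < U_A`, box `[p, q] × [U_A, U_max]` with `p < q ≤ 0`, density `0 ≤ n < 2`.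
Two unconditional orbit-lower families on the station segment `s ∈ [p(2 − U_A/U_max), q]` (torus-limit ground-state classes at `(s, U_A, n)`): `vP s` for the
objective `−X₀(p, U_A)` (the large-`|t′|` END slot) and `vQ s` for `−X₀(q, U_A)` (the small-`|t′|` END slot) — the SAME vertex solves read with two
objectives, each interpolated along `s` as usual. Price: for every target slot `σ ∈ [p, q]` and source `s ∈ [σ(2 − U_A/U_max), σ]`, the negated `σ`-CHORD
`−((q − σ)vP s + (σ − p)vQ s)/(q − p) ≤ c` (affine in `σ` at fixed `s`; `c ≥ max(−vP, −vQ)` on the used pairs suffices). Then `ObsStiffnessSeqCeilingAt t′ U n c`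
on the whole box: the σ-chord of the two families IS a target-slot family (`orbitLower_slot_chord_of_two_endObjectives`), and §1 applies. No «min K₂diag»
word, no particle–hole window, no lever, no joint `(s, σ)` certificate. [cite: KomaTasaki1994, §1] [cite: ScalapinoWhiteZhang1993, §II] -/
theorem ObsStiffnessSeqCeilingAt_on_box_of_apexStation_twoEndObjectives (hUA : 0 < UA) (hq : q ≤ 0) (hpq : p < q) (hn0 : 0 ≤ n)
    (hn2 : n < 2) (vP vQ : ℝ → ℝ) (c : ℚ)
    (hP : ∀ s ∈ Set.Icc (p * (2 - UA / Umax)) q,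
      ∀ (ω : InfVolFermionState 2) (Ls : ℕ → ℕ) (ψ : ∀ L, Fock (Orb (FermionTorus 2 L))),
      Tendsto Ls atTop atTop →
      (∀ j, IsGroundStateInSector (hubbardTorusTT' (Ls j) 1 s UA) (rectN n (Ls j)) 0 (ψ (Ls j))) →
      (∀ j, star (ψ (Ls j)) ⬝ᵥ ψ (Ls j) = 1) → ω.IsTorusLimitOf ψ Ls →
      vP s ≤ ((Finset.univ : Finset (DihedralGroup 4)).card : ℝ)⁻¹ * ∑ g ∈ (Finset.univ : Finset (DihedralGroup 4)),
        (ω.expect (d4ShiftSet g 0 (box 2 7)) (fermionEmbed (PolySite.d4Emb g 0 (box 2 7)) (-oddMomentObsTT p UA 0))).re)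
    (hQ : ∀ s ∈ Set.Icc (p * (2 - UA / Umax)) q,
      ∀ (ω : InfVolFermionState 2) (Ls : ℕ → ℕ) (ψ : ∀ L, Fock (Orb (FermionTorus 2 L))),
      Tendsto Ls atTop atTop →
      (∀ j, IsGroundStateInSector (hubbardTorusTT' (Ls j) 1 s UA) (rectN n (Ls j)) 0 (ψ (Ls j))) →
      (∀ j, star (ψ (Ls j)) ⬝ᵥ ψ (Ls j) = 1) → ω.IsTorusLimitOf ψ Ls →
      vQ s ≤ ((Finset.univ : Finset (DihedralGroup 4)).card : ℝ)⁻¹ * ∑ g ∈ (Finset.univ : Finset (DihedralGroup 4)),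
        (ω.expect (d4ShiftSet g 0 (box 2 7)) (fermionEmbed (PolySite.d4Emb g 0 (box 2 7)) (-oddMomentObsTT q UA 0))).re)
    (hc : ∀ σ ∈ Set.Icc p q, ∀ s ∈ Set.Icc (σ * (2 - UA / Umax)) σ,
      -((q - σ) / (q - p) * vP s + (σ - p) / (q - p) * vQ s) ≤ ((c : ℚ) : ℝ)) :
    ∀ tp ∈ Set.Icc p q, ∀ U ∈ Set.Icc UA Umax, ObsStiffnessSeqCeilingAt tp U n c := by
  intro tp htp U hU
  have hUmax : UA ≤ Umax := hU.1.trans hU.2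
  have hf : 0 ≤ 2 - UA / Umax := by
    have : UA / Umax ≤ 1 := (div_le_one (hUA.trans_le hUmax)).2 hUmax
    linarith
  refine ObsStiffnessSeqCeilingAt_on_box_of_apexStation_targetSlot hUA hq hn0 hn2
    (fun σ s => (q - σ) / (q - p) * vP s + (σ - p) / (q - p) * vQ s) c (fun σ hσ s hs ω Ls ψ hLs hψ h1 hω => ?_) hc tp htp U hU
  -- the sources of the slot `σ` lie on the station segment `[p(2 − U_A/U_max), q]`
  have hseg : s ∈ Set.Icc (p * (2 - UA / Umax)) q :=
    ⟨(mul_le_mul_of_nonneg_right hσ.1 hf).trans hs.1, hs.2.trans hσ.2⟩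
  exact orbitLower_slot_chord_of_two_endObjectives hω.isTranslationInvariant UA hpq hσ (hP s hseg ω Ls ψ hLs hψ h1 hω)
    (hQ s hseg ω Ls ψ hLs hψ h1 hω)

end TwoEndObjectives

end Summit.Ventures.CertifiedManyBodySolver.Observables

end
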